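import Literature.MathematicalPhysics.QuantumFieldTheory.Balaban1983to89.Node00.CarriersB8SubBP
import Summits.QuantumFields.YangMills.Theorems.BalabanUVNodesN16PinnedPCarrierBridge
import Summits.QuantumFields.YangMills.Theorems.BalabanUVNodesN16OfSocketsAllTorusPinned
import HarnessLib

/-!
# Route «BalabanUVNodes», cluster K4 «SpineRates» — node N16 = NE3: THE P-SLOT → `h5` ADAPTER (trigger (t-P)) — node N05's Theorem-4 ∕ Proposition-3
# conjuncts ON THE P-CARRIER over n05-c's FOUR-LAW SUB-INDEX (the `t4P` ∕ `p3P` conjuncts of n05-w1's slot `Node00.B8LeafOfRecordSubBP θ λ`) RESTRICTED to N16's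
# PINNED ALL-TORUS MEMBERS give node N16's per-family hypothesis `h5` (module 37ᴴ ∕ `N16DischargeTest.stub_h5`): stage-free at N16's objects (§1–§2) and at
# any Stage-3 parameter `θ` in θ's currency (§3)

Cell `pub-ymgap`, width seat `pub-ymgap-dag-n16-w2` (g2, harness re-seat of g0; director-ym №197 ∕ HUMAN RULING D-0149), node N16.
`--kind proof --supports stmt-QuantumFields-20544 --as helper` (K3⁷ `SpineGivenEndpointR13SepCoPH`).  `bears_on: R4∕N16 · edge N05 → N16`.

WHY (trigger (t-P), dag-n16-e g15's word on the cell bus l.26184 «w2 TYPE IT when the P-pin lands»).  Node N16 reads node N05 ONLY through module 37ᴴ's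
per-family hypothesis `h5` (`…N16OfEdgesAllTorusAtRecord13CoPH` :160; the evidence file's `N16DischargeTest.stub_h5 β F`): a length letter, constants, an
eleven-line smallness window and node N05's two conjuncts `B8.Thm4Body c₁ B₁'` ∕ `B8.Prop3Body cP 4 F.L C₂ inp B₀β` on n05-a's family `zdGF3 (M_N ℂ) F.L β len`
over the PINNED all-torus members `{i : ZdIdx 4 F.L // (∀ j, i.Ω j = univ) ∧ (∀ m j, i.Λs m j = {j = m}) ∧ (∀ m j, i.Λb m j = {j = m}) ∧ i.η = (F.L⁻¹)^{i.k}}`.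
Node N05's line now concludes its [Balaban1985RegularSpaces] group on the P-CARRIER: n05-w1's slot `Node00.B8LeafOfRecordSubBP θ λ` (p592605) whose reading
`b8LeafOfRecordSubBP_iff_classFree_and_P` displays, among nine conjuncts, `t4P : B8.Thm4Printed λ.B₁' (fun j : IdxB8SubB θ ↦ (zdGF3P θ.𝔸 θ.L λ.β λ.len j.1.1).toGFData)`
and `p3P : B8.Prop3Printed θ.D θ.L λ.C₂ λ.inp λ.B₀β (fun j ↦ (zdGF3P … j.1.1).toGFData2)` over n05-c's four-law sub-index `IdxB8SubB θ = {i : {i : ZdIdx θ.D θ.L // i.Ω 0 = univ}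
// IdxB8LawsB θ.L i.1}` — the targets of the γ D-chain (dag-n05-d ∕ n05-w2 ∕ n05-w3).  Two landed facts make these EXACTLY what `h5` asks: every pinned member obeys the
four index laws (dag-n16-c F47 §1 `idxB8LawsB_allTorusPinned` = n05-c `idxB8LawsB_of_member_univ`), and at a pinned member the P-carrier IS `zdGF3` (this seat's g0
`…N16PinnedPCarrierBridge.zdGF3P_pinned_eq`, `thm4Body_zdGF3P_pinned_iff`, `prop3Body_zdGF3P_pinned_iff`).  THIS FILE composes them: restriction along the inclusion
«pinned ↪ four-law sub-index» (a `B8.Thm4Body` ∕ `B8.Prop3Body` sentence is a `∀ i`), the pinned `Iff`s, and dag-n16-c's `exists_window_print` for the letter `c₁′`.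

WHAT THIS FILE PROVES (kernel bookkeeping; 0 `def`, 0 `sorry`):
* §1 STAGE-FREE, any C⋆-algebra `𝔸`, any `d`, `L ≥ 1`, `β`, `len`, constants: `thm4Body_pinned_of_subBP` · `prop3Body_pinned_of_subBP` · `thm4Printed_pinned_of_subBP` ·
  `prop3Printed_pinned_of_subBP` — node N05's sentence on the P-family over the four-law sub-index ⟹ the same sentence (same constants) on N16's pinned `zdGF3` family.
* §2 ★ `h5_of_t4P_p3P` (`d = 4`, `𝔸 = M_N(ℂ)` with the statement-assembled `L²`-operator-norm C⋆-structure, any `L ≥ 2`, `β`, `len`): the two P-conjuncts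
  `B8.Thm4Printed B₁'` ∕ `B8.Prop3Printed 4 L C₂ inp B₀β` over the four-law sub-index, with the side letters `len ≥ 1` on its support, `len e_μ = 1`, `0 < B₁'`,
  `5·4·L·inp.B₀ ≤ B₁'`, give 37ᴴ's `h5 F` ∕ `stub_h5 β F` BODY VERBATIM at `L := F.L` (the window letter `c₁′` from `exists_window_print`).  This is the N16-side face a
  supplier of the two P-conjuncts at N16's objects plugs into by `exact` (node N05's γ-suppliers are (𝔸, d, L, ι)-generic: instantiate at `(M_N ℂ, 4, F.L, ι := (·.1.1))`).
  `h5MS_of_t4P_p3P` — the same in the R-β″ shape (length letter `len (j • e_μ) = j`, 37ᴴ's MS edition).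
* §3 θ-LEVEL, any `θ : Stage3Params`, `λ : ResidB8 θ`: `thm4Body_pinned_of_t4P` · `prop3Body_pinned_of_p3P` · ★ `leafLettersAT_of_b8LeafOfRecordSubBP` (the SLOT + `2 ≤ θ.D` +
  `0 < λ.B₁'` ⟹ `∃ c₁ c₁′ cP`, window at `(θ.D, θ.L, λ.B₁', λ.C₂)` ∧ `Thm4Body c₁ λ.B₁'` ∧ `Prop3Body cP θ.D θ.L λ.C₂ λ.inp λ.B₀β` on the pinned `zdGF3 θ.𝔸 θ.L λ.β λ.len` family) ·
  ★ `h5Letters_of_b8LeafOfRecordSubBP` (+ the side letters on `λ.len`, `λ.inp.B₀` ⟹ the `h5`-SHAPED existential IN θ's CURRENCY: `len := λ.len`, `B₁' := λ.B₁'`, `C₂ := λ.C₂`,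
  `B₀β := λ.B₀β`, `inp := λ.inp`).

* §4 (v1.1, APPEND-ONLY; §§1–3 byte-identical) `h5_of_printed_pinned` · `h5_of_printedP_pinned` — the WEAKEST node-N05-side currency: Theorem 4 ∕ Proposition 3 AS PRINTED on
  the PINNED `zdGF3` (resp. `zdGF3P`) family ONLY + the side letters ⟹ `h5` (N16's minimal demand; §2's whole-sub-index hypotheses imply it by §1, not conversely).

LOCATED (decl level; dag-n16-e g10's datum D2, cell bus l.21644, restated at the P-slot — nothing new is claimed).  §3 is `h5` in θ's currency: it is 37ᴴ's `h5 F` verbatim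
ONLY at a Stage-3 parameter with `(θ.𝔸, θ.D, θ.L) ≡ (M_N ℂ, 4, F.L)` definitionally.  The tree's Stage-3 dictionary OF THE FAMILY, `Node00.stage3OfFamily F`
(`Record12NumericsFamilyDict` :54 over `Record12Numerics.stage3OfRecord₁₂` :165; = `(Node00.theta13OfNumerics F N …).toStage3Params`, `Record13LiveSelectorFamily` :224, hence
the K0⁷ family `theta13OfThm1CCM`), has `𝔸 := ℂ`, `D := 4`, `L := F.L`: at those tuples the P-slot speaks of `zdGF3P ℂ F.L` (rank-one colour algebra), not of `M_N ℂ`, so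
§3 does not become `stub_h5` by `rfl` there — §2 is the consumable face; a Stage-3 dictionary with `𝔸 := MatA N` would be NODE 00's pen (not filed here, not asked).

HONEST FRAMING.  Restriction ∕ `Iff` ∕ window bookkeeping over landed definitions; no estimate; nothing of [Balaban1985RegularSpaces] asserted; whether Theorem 4 ∕
Proposition 3 HOLD at the P-members is node N05's ∕ N06's open content (dag-n05-d's γ D-chain; at the pinned members the Prop-3 frame is [Balaban1985BackgroundPropagators]
Thm 3.3 in the no-holes geometry, N06's); **N16 ∕ N05 ∕ N06 NOT discharged**; count-neutral (typed 28∕28 · discharged 5∕27 UNMOVED); one finite four-torus at fixed ε —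
NOT ℝ⁴, NOT infinite volume, NOT OS, NOT a mass gap, NOT Clay.  No `sorry`, no `def`, no `instance`, no `notation`.
-/

set_option autoImplicit false

open scoped BigOperators Matrix Matrix.Norms.L2Operator
open NormedSpace

noncomputable section

namespace Summit.QuantumFields.YangMills.BalabanUVNodes.N16H5OfPSlot

open Literature.MathematicalPhysics.QuantumFieldTheory.Balaban1983to89
open B7Prop1Explicit B7Prop2Explicit
open B7Prop3Flat (c3)
open B8LeafModelZd (ZdIdx)
open B8LeafModelZd3 (zdGF3)
open B8LeafModelZd3P (zdGF3P)
open B8IdxB8LawsB (IdxB8LawsB IdxB8SubB)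
open Node00 (Stage3Params ResidB8 B8LeafOfRecordSubBP)
open Summit.QuantumFields.YangMills.BalabanUVNodes.N16PinnedPCarrierBridge (thm4Body_zdGF3P_pinned_iff prop3Body_zdGF3P_pinned_iff)
open Summit.QuantumFields.YangMills.BalabanUVNodes.N16OfSocketsAllTorusPinned (idxB8LawsB_allTorusPinned)
open Summit.QuantumFields.YangMills.BalabanUVNodes.N16.OfLeaf (exists_window_print)

/-! ## §1 Stage-free: node N05's sentence on the P-family over the four-law sub-index restricts to N16's pinned `zdGF3` family -/

section StageFree

variable {d : ℕ} {𝔸 : Type} [CStarAlgebra 𝔸] {L : ℕ} {β : ℝ} {len : Site d → ℝ}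

/-- **THEOREM 4's BODY ON THE P-FAMILY OVER THE FOUR-LAW SUB-INDEX ⟹ ON N16's PINNED `zdGF3` FAMILY** (same `c₁`, `B₁′`): every pinned all-torus member lies in the four-law
sub-index (dag-n16-c F47 §1 `idxB8LawsB_allTorusPinned`), a `B8.Thm4Body` sentence is a `∀ i`, and at a pinned member the P-carrier is `zdGF3` (g0's `thm4Body_zdGF3P_pinned_iff`).
[cite: Balaban1985RegularSpaces, Thm 4 p.88, p.77 («we admit Ω_j = T_η»), (1.31) p.82 (bookkeeping: restriction of the family index)] -/
theorem thm4Body_pinned_of_subBP (hL : 1 ≤ L) (c₁ B₁' : ℝ)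
    (h : B8.Thm4Body c₁ B₁' (fun j : {i : {i : ZdIdx d L // i.Ω 0 = Set.univ} // IdxB8LawsB L i.1} => (zdGF3P 𝔸 L β len j.1.1).toGFData)) :
    B8.Thm4Body c₁ B₁' (fun i : {i : ZdIdx d L // (∀ j, i.Ω j = Set.univ) ∧ (∀ m j, i.Λs m j = {_y | j = m}) ∧ (∀ m j, i.Λb m j = {_c | j = m}) ∧
        i.η = ((L : ℝ)⁻¹) ^ i.k} => (zdGF3 𝔸 L β len i.1).toGFData) :=
  (thm4Body_zdGF3P_pinned_iff (𝔸 := 𝔸) (β := β) (len := len) c₁ B₁').1 fun i =>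
    h ⟨⟨i.1, i.2.1 0⟩, idxB8LawsB_allTorusPinned hL i⟩

/-- **PROPOSITION 3's BODY ON THE P-FAMILY OVER THE FOUR-LAW SUB-INDEX ⟹ ON N16's PINNED `zdGF3` FAMILY** (same `cP`, `C₂`, `inp`, `B₀(β₀)`; g0's `prop3Body_zdGF3P_pinned_iff`).
[cite: Balaban1985RegularSpaces, Prop. 3 p.87, p.77, (1.31) p.82 (bookkeeping: restriction of the family index)] -/
theorem prop3Body_pinned_of_subBP (hL : 1 ≤ L) (cP C₂ : ℝ) (inp : B8.B9Inputs) (B₀β : ℝ)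
    (h : B8.Prop3Body cP d (L : ℝ) C₂ inp B₀β (fun j : {i : {i : ZdIdx d L // i.Ω 0 = Set.univ} // IdxB8LawsB L i.1} => (zdGF3P 𝔸 L β len j.1.1).toGFData2)) :
    B8.Prop3Body cP d (L : ℝ) C₂ inp B₀β (fun i : {i : ZdIdx d L // (∀ j, i.Ω j = Set.univ) ∧ (∀ m j, i.Λs m j = {_y | j = m}) ∧ (∀ m j, i.Λb m j = {_c | j = m}) ∧
        i.η = ((L : ℝ)⁻¹) ^ i.k} => (zdGF3 𝔸 L β len i.1).toGFData2) :=
  (prop3Body_zdGF3P_pinned_iff (𝔸 := 𝔸) (β := β) (len := len) cP C₂ inp B₀β).1 fun i =>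
    h ⟨⟨i.1, i.2.1 0⟩, idxB8LawsB_allTorusPinned hL i⟩

/-- **THEOREM 4 AS PRINTED (`∃ c₁ > 0, …`) ON THE P-FAMILY OVER THE FOUR-LAW SUB-INDEX ⟹ ON N16's PINNED `zdGF3` FAMILY** (same `B₁′`; the conjunct `t4P` of n05-w1's slot reading
`Node00.b8LeafOfRecordSubBP_iff_classFree_and_P`, stage-free). [cite: Balaban1985RegularSpaces, Thm 4 p.88 («There exists a constant c₁»), p.77 (bookkeeping)] -/
theorem thm4Printed_pinned_of_subBP (hL : 1 ≤ L) (B₁' : ℝ)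
    (h : B8.Thm4Printed B₁' (fun j : {i : {i : ZdIdx d L // i.Ω 0 = Set.univ} // IdxB8LawsB L i.1} => (zdGF3P 𝔸 L β len j.1.1).toGFData)) :
    B8.Thm4Printed B₁' (fun i : {i : ZdIdx d L // (∀ j, i.Ω j = Set.univ) ∧ (∀ m j, i.Λs m j = {_y | j = m}) ∧ (∀ m j, i.Λb m j = {_c | j = m}) ∧
        i.η = ((L : ℝ)⁻¹) ^ i.k} => (zdGF3 𝔸 L β len i.1).toGFData) := by
  obtain ⟨c₁, hc₁, hT⟩ := h
  exact ⟨c₁, hc₁, thm4Body_pinned_of_subBP hL c₁ B₁' hT⟩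

/-- **PROPOSITION 3 AS PRINTED (`∃ c > 0, …`) ON THE P-FAMILY OVER THE FOUR-LAW SUB-INDEX ⟹ ON N16's PINNED `zdGF3` FAMILY** (the conjunct `p3P` of the slot reading, stage-free).
[cite: Balaban1985RegularSpaces, Prop. 3 p.87 («bounded by a constant depending on d and L only»), p.77 (bookkeeping)] -/
theorem prop3Printed_pinned_of_subBP (hL : 1 ≤ L) (C₂ : ℝ) (inp : B8.B9Inputs) (B₀β : ℝ)
    (h : B8.Prop3Printed d (L : ℝ) C₂ inp B₀β (fun j : {i : {i : ZdIdx d L // i.Ω 0 = Set.univ} // IdxB8LawsB L i.1} => (zdGF3P 𝔸 L β len j.1.1).toGFData2)) :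
    B8.Prop3Printed d (L : ℝ) C₂ inp B₀β (fun i : {i : ZdIdx d L // (∀ j, i.Ω j = Set.univ) ∧ (∀ m j, i.Λs m j = {_y | j = m}) ∧ (∀ m j, i.Λb m j = {_c | j = m}) ∧
        i.η = ((L : ℝ)⁻¹) ^ i.k} => (zdGF3 𝔸 L β len i.1).toGFData2) := by
  obtain ⟨cP, hcP, hP⟩ := h
  exact ⟨cP, hcP, prop3Body_pinned_of_subBP hL cP C₂ inp B₀β hP⟩

end StageFree

/-! ## §2 ★ At N16's objects (`d = 4`, `𝔸 = M_N(ℂ)`): the two P-conjuncts + side letters give 37ᴴ's `h5` ∕ `stub_h5` body VERBATIM -/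

section Matrices

variable {N : ℕ}

/-- ★ **37ᴴ's PER-FAMILY HYPOTHESIS `h5` ∕ `N16DischargeTest.stub_h5 β F` FROM NODE N05's TWO P-CONJUNCTS AT N16's OBJECTS** (`d = 4`, colour algebra `M_N(ℂ)` with the
`L²`-operator-norm C⋆-structure assembled in the statement, any `L ≥ 2` — read `L := F.L` —, any exponent `β` and length letter `len`): Theorem 4 as printed with constant `B₁′`
and Proposition 3 as printed with `C₂, inp, B₀(β₀)` on the P-family `fun j ↦ zdGF3P (M_N ℂ) L β len j.1.1` over the four-law sub-index `{i : {i : ZdIdx 4 L // i.Ω 0 = univ} // IdxB8LawsB L i.1}`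
(n05-w1's `t4P` ∕ `p3P` at these letters), together with the side letters `len ≥ 1` on its support, `len e_μ = 1`, `0 < B₁′`, `5·4·L·B₀ ≤ B₁′`, give the `h5` body: the window
letter `c₁′` is dag-n16-c's `exists_window_print`, the two conjuncts restrict to the pinned members by §1.  Nothing of Bałaban is proved: the two P-conjuncts are node
N05's ∕ N06's open obligations. [cite: Balaban1985RegularSpaces, Thm 4 p.88, Prop. 3 p.87, (1.61) p.86, p.77 («Ω_j = T_η»)] [folklore] -/
theorem h5_of_t4P_p3P {L : ℕ} (hL : 2 ≤ L) (β : ℝ) {len : Site 4 → ℝ} (hlen : ∀ v : Site 4, 0 < len v → 1 ≤ len v) (hlen1 : ∀ μ : Fin 4, len (e μ) = 1)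
    {B₁' C₂ B₀β : ℝ} {inp : B8.B9Inputs} (hB₁' : 0 < B₁') (hBB : 5 * ((4 : ℕ) : ℝ) * L * inp.B₀ ≤ B₁') :
    letI : CStarAlgebra (Matrix (Fin N) (Fin N) ℂ) := {}
    B8.Thm4Printed B₁' (fun j : {i : {i : ZdIdx 4 L // i.Ω 0 = Set.univ} // IdxB8LawsB L i.1} => (zdGF3P (Matrix (Fin N) (Fin N) ℂ) L β len j.1.1).toGFData) →
    B8.Prop3Printed 4 (L : ℝ) C₂ inp B₀β (fun j : {i : {i : ZdIdx 4 L // i.Ω 0 = Set.univ} // IdxB8LawsB L i.1} => (zdGF3P (Matrix (Fin N) (Fin N) ℂ) L β len j.1.1).toGFData2) →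
    ∃ (len : Site 4 → ℝ) (c₁ c₁' B₁' cP C₂ B₀β : ℝ) (inp : B8.B9Inputs),
      (∀ v : Site 4, 0 < len v → 1 ≤ len v) ∧ (∀ μ : Fin 4, len (e μ) = 1) ∧ 0 < B₁' ∧ 5 * ((4 : ℕ) : ℝ) * L * inp.B₀ ≤ B₁' ∧ 0 < c₁' ∧
      (∀ α₀ α₁ : ℝ, 0 < α₀ → 0 < α₁ → α₀ + α₁ ≤ c₁' →
        α₀ + α₁ ≤ c₁ ∧ C0 4 * (2 * α₀) ≤ 1 / 3 ∧ 4 * α₀ ≤ c2' 4 L ∧ 16 * (B₁' * (α₀ + α₁)) ≤ 1 ∧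
        Real.exp (4 * (800 * (((4 : ℕ) : ℝ) + 1) ^ 2 * (((4 : ℕ) : ℝ) + 4)) * α₀) * (1 + 8 * (131072 * (((4 : ℕ) : ℝ) + 1) ^ 2) * (B₁' * (α₀ + α₁))) ≤ 2 ∧
        2 * (B₁' * (α₀ + α₁)) ≤ c3 4 L ∧ ((4 : ℕ) : ℝ) * L * α₁ ≤ 1 / 8 ∧ α₀ ≤ cP ∧ α₁ ≤ cP ∧ B₁' * (α₀ + α₁) ≤ cP ∧
        2 * (B₁' * (α₀ + α₁)) ^ 2 + 20 * ((4 : ℕ) : ℝ) * α₀ * (B₁' * (α₀ + α₁)) + 2 * C₂ * (B₁' * (α₀ + α₁)) ^ 2 ≤ α₀ + α₁) ∧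
      B8.Thm4Body c₁ B₁' (fun i : {i : ZdIdx 4 L // (∀ j, i.Ω j = Set.univ) ∧ (∀ m j, i.Λs m j = {_y | j = m}) ∧ (∀ m j, i.Λb m j = {_c | j = m}) ∧ i.η = ((L : ℝ)⁻¹) ^ i.k} => (zdGF3 (Matrix (Fin N) (Fin N) ℂ) L β len i.1).toGFData) ∧
      B8.Prop3Body cP 4 (L : ℝ) C₂ inp B₀β (fun i : {i : ZdIdx 4 L // (∀ j, i.Ω j = Set.univ) ∧ (∀ m j, i.Λs m j = {_y | j = m}) ∧ (∀ m j, i.Λb m j = {_c | j = m}) ∧ i.η = ((L : ℝ)⁻¹) ^ i.k} => (zdGF3 (Matrix (Fin N) (Fin N) ℂ) L β len i.1).toGFData2) := by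
  letI : CStarAlgebra (Matrix (Fin N) (Fin N) ℂ) := {}
  intro t4 p3
  obtain ⟨c₁, hc₁, hT⟩ := t4
  obtain ⟨cP, hcP, hP⟩ := p3
  -- the window letter below the two printed thresholds (dag-n16-c)
  obtain ⟨c₁', hc₁', hwin⟩ := exists_window_print (d := 4) (L := L) (by norm_num) hL C₂ hc₁ hcP hB₁'
  have hL1 : 1 ≤ L := le_trans (by norm_num) hL
  exact ⟨len, c₁, c₁', B₁', cP, C₂, B₀β, inp, hlen, hlen1, hB₁', hBB, hc₁', hwin,
    thm4Body_pinned_of_subBP (𝔸 := Matrix (Fin N) (Fin N) ℂ) hL1 c₁ B₁' hT,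
    prop3Body_pinned_of_subBP (𝔸 := Matrix (Fin N) (Fin N) ℂ) hL1 cP C₂ inp B₀β hP⟩

/-- **THE SAME IN THE R-β″ (MULTI-SCALE LENGTH LETTER) SHAPE** — 37ᴴ's `h5` of `exists_letters_s_N16HolderMS_readingOfRecord₁₃CoPHOn_of_edges_allTorus`, whose second side letter reads
`∀ μ j, len (j • e_μ) = j` instead of `len e_μ = 1` (the latter follows at `j = 1` and feeds the window ∕ restriction exactly as in `h5_of_t4P_p3P`).  Nothing of Bałaban is proved.
[cite: Balaban1985RegularSpaces, Thm 4 p.88, Prop. 3 p.87, (1.61) p.86, p.77] [folklore] -/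
theorem h5MS_of_t4P_p3P {L : ℕ} (hL : 2 ≤ L) (β : ℝ) {len : Site 4 → ℝ} (hlen : ∀ v : Site 4, 0 < len v → 1 ≤ len v) (hlenj : ∀ (μ : Fin 4) (j : ℕ), len (j • e μ) = j)
    {B₁' C₂ B₀β : ℝ} {inp : B8.B9Inputs} (hB₁' : 0 < B₁') (hBB : 5 * ((4 : ℕ) : ℝ) * L * inp.B₀ ≤ B₁') :
    letI : CStarAlgebra (Matrix (Fin N) (Fin N) ℂ) := {}
    B8.Thm4Printed B₁' (fun j : {i : {i : ZdIdx 4 L // i.Ω 0 = Set.univ} // IdxB8LawsB L i.1} => (zdGF3P (Matrix (Fin N) (Fin N) ℂ) L β len j.1.1).toGFData) →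
    B8.Prop3Printed 4 (L : ℝ) C₂ inp B₀β (fun j : {i : {i : ZdIdx 4 L // i.Ω 0 = Set.univ} // IdxB8LawsB L i.1} => (zdGF3P (Matrix (Fin N) (Fin N) ℂ) L β len j.1.1).toGFData2) →
    ∃ (len : Site 4 → ℝ) (c₁ c₁' B₁' cP C₂ B₀β : ℝ) (inp : B8.B9Inputs),
      (∀ v : Site 4, 0 < len v → 1 ≤ len v) ∧ (∀ (μ : Fin 4) (j : ℕ), len (j • e μ) = j) ∧ 0 < B₁' ∧ 5 * ((4 : ℕ) : ℝ) * L * inp.B₀ ≤ B₁' ∧ 0 < c₁' ∧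
      (∀ α₀ α₁ : ℝ, 0 < α₀ → 0 < α₁ → α₀ + α₁ ≤ c₁' →
        α₀ + α₁ ≤ c₁ ∧ C0 4 * (2 * α₀) ≤ 1 / 3 ∧ 4 * α₀ ≤ c2' 4 L ∧ 16 * (B₁' * (α₀ + α₁)) ≤ 1 ∧
        Real.exp (4 * (800 * (((4 : ℕ) : ℝ) + 1) ^ 2 * (((4 : ℕ) : ℝ) + 4)) * α₀) * (1 + 8 * (131072 * (((4 : ℕ) : ℝ) + 1) ^ 2) * (B₁' * (α₀ + α₁))) ≤ 2 ∧
        2 * (B₁' * (α₀ + α₁)) ≤ c3 4 L ∧ ((4 : ℕ) : ℝ) * L * α₁ ≤ 1 / 8 ∧ α₀ ≤ cP ∧ α₁ ≤ cP ∧ B₁' * (α₀ + α₁) ≤ cP ∧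
        2 * (B₁' * (α₀ + α₁)) ^ 2 + 20 * ((4 : ℕ) : ℝ) * α₀ * (B₁' * (α₀ + α₁)) + 2 * C₂ * (B₁' * (α₀ + α₁)) ^ 2 ≤ α₀ + α₁) ∧
      B8.Thm4Body c₁ B₁' (fun i : {i : ZdIdx 4 L // (∀ j, i.Ω j = Set.univ) ∧ (∀ m j, i.Λs m j = {_y | j = m}) ∧ (∀ m j, i.Λb m j = {_c | j = m}) ∧ i.η = ((L : ℝ)⁻¹) ^ i.k} => (zdGF3 (Matrix (Fin N) (Fin N) ℂ) L β len i.1).toGFData) ∧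
      B8.Prop3Body cP 4 (L : ℝ) C₂ inp B₀β (fun i : {i : ZdIdx 4 L // (∀ j, i.Ω j = Set.univ) ∧ (∀ m j, i.Λs m j = {_y | j = m}) ∧ (∀ m j, i.Λb m j = {_c | j = m}) ∧ i.η = ((L : ℝ)⁻¹) ^ i.k} => (zdGF3 (Matrix (Fin N) (Fin N) ℂ) L β len i.1).toGFData2) := by
  letI : CStarAlgebra (Matrix (Fin N) (Fin N) ℂ) := {}
  intro t4 p3
  obtain ⟨c₁, hc₁, hT⟩ := t4
  obtain ⟨cP, hcP, hP⟩ := p3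
  obtain ⟨c₁', hc₁', hwin⟩ := exists_window_print (d := 4) (L := L) (by norm_num) hL C₂ hc₁ hcP hB₁'
  have hL1 : 1 ≤ L := le_trans (by norm_num) hL
  exact ⟨len, c₁, c₁', B₁', cP, C₂, B₀β, inp, hlen, hlenj, hB₁', hBB, hc₁', hwin,
    thm4Body_pinned_of_subBP (𝔸 := Matrix (Fin N) (Fin N) ℂ) hL1 c₁ B₁' hT,
    prop3Body_pinned_of_subBP (𝔸 := Matrix (Fin N) (Fin N) ℂ) hL1 cP C₂ inp B₀β hP⟩

end Matrices

/-! ## §3 θ-level: from n05-w1's slot `Node00.B8LeafOfRecordSubBP θ λ` (any Stage-3 parameter `θ`), in θ's currency -/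

section Slot

variable {θ : Stage3Params}

/-- **The slot's Theorem-4 conjunct, at a threshold `c₁`, restricted to the pinned members of `(θ.D, θ.L)`** (§1 at `IdxB8SubB θ`, which unfolds to the four-law sub-index
at `(θ.D, θ.L)`; `1 ≤ θ.L` from Bałaban's odd `L > 1`). [cite: Balaban1985RegularSpaces, Thm 4 p.88, p.77 (bookkeeping)] -/
theorem thm4Body_pinned_of_t4P (lam : ResidB8 θ) {c₁ : ℝ}
    (h : B8.Thm4Body c₁ lam.B₁' (fun j : IdxB8SubB θ => (zdGF3P θ.𝔸 θ.L lam.β lam.len j.1.1).toGFData)) :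
    B8.Thm4Body c₁ lam.B₁' (fun i : {i : ZdIdx θ.D θ.L // (∀ j, i.Ω j = Set.univ) ∧ (∀ m j, i.Λs m j = {_y | j = m}) ∧ (∀ m j, i.Λb m j = {_c | j = m}) ∧
        i.η = ((θ.L : ℝ)⁻¹) ^ i.k} => (zdGF3 θ.𝔸 θ.L lam.β lam.len i.1).toGFData) :=
  thm4Body_pinned_of_subBP (𝔸 := θ.𝔸) (β := lam.β) (len := lam.len) (le_trans (by norm_num) θ.two_le_L) c₁ lam.B₁' h

/-- **The slot's Proposition-3 conjunct, at a threshold `cP`, restricted to the pinned members of `(θ.D, θ.L)`**. [cite: Balaban1985RegularSpaces, Prop. 3 p.87, p.77 (bookkeeping)] -/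
theorem prop3Body_pinned_of_p3P (lam : ResidB8 θ) {cP : ℝ}
    (h : B8.Prop3Body cP θ.D (θ.L : ℝ) lam.C₂ lam.inp lam.B₀β (fun j : IdxB8SubB θ => (zdGF3P θ.𝔸 θ.L lam.β lam.len j.1.1).toGFData2)) :
    B8.Prop3Body cP θ.D (θ.L : ℝ) lam.C₂ lam.inp lam.B₀β (fun i : {i : ZdIdx θ.D θ.L // (∀ j, i.Ω j = Set.univ) ∧ (∀ m j, i.Λs m j = {_y | j = m}) ∧
        (∀ m j, i.Λb m j = {_c | j = m}) ∧ i.η = ((θ.L : ℝ)⁻¹) ^ i.k} => (zdGF3 θ.𝔸 θ.L lam.β lam.len i.1).toGFData2) :=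
  prop3Body_pinned_of_subBP (𝔸 := θ.𝔸) (β := lam.β) (len := lam.len) (le_trans (by norm_num) θ.two_le_L) cP lam.C₂ lam.inp lam.B₀β h

/-- ★ **THE AT LEAF LETTERS OF N16 FROM n05-w1's P-SLOT, IN θ's CURRENCY**: `Node00.B8LeafOfRecordSubBP θ λ` (through its `t4P` ∕ `p3P` projections), `2 ≤ θ.D` and `0 < λ.B₁′`
give thresholds `c₁, cP` and a window letter `c₁′ > 0` with the eleven-line window at `(θ.D, θ.L, λ.B₁′, λ.C₂)` (dag-n16-c's `exists_window_print`) and node N05's two conjuncts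
`B8.Thm4Body c₁ λ.B₁′` ∕ `B8.Prop3Body cP θ.D θ.L λ.C₂ λ.inp λ.B₀β` on the PINNED `zdGF3 θ.𝔸 θ.L λ.β λ.len` family.  The other seven conjuncts of the slot are not read.
[cite: Balaban1985RegularSpaces, Thm 4 p.88, Prop. 3 p.87, (1.61) p.86, p.77] [folklore] -/
theorem leafLettersAT_of_b8LeafOfRecordSubBP (hD : 2 ≤ θ.D) (lam : ResidB8 θ) (hB₁' : 0 < lam.B₁') (h : B8LeafOfRecordSubBP θ lam) :
    ∃ c₁ c₁' cP : ℝ, 0 < c₁' ∧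
      (∀ α₀ α₁ : ℝ, 0 < α₀ → 0 < α₁ → α₀ + α₁ ≤ c₁' →
        α₀ + α₁ ≤ c₁ ∧ C0 θ.D * (2 * α₀) ≤ 1 / 3 ∧ 4 * α₀ ≤ c2' θ.D θ.L ∧ 16 * (lam.B₁' * (α₀ + α₁)) ≤ 1 ∧
        Real.exp (4 * (800 * ((θ.D : ℝ) + 1) ^ 2 * ((θ.D : ℝ) + 4)) * α₀) * (1 + 8 * (131072 * ((θ.D : ℝ) + 1) ^ 2) * (lam.B₁' * (α₀ + α₁))) ≤ 2 ∧
        2 * (lam.B₁' * (α₀ + α₁)) ≤ c3 θ.D θ.L ∧ (θ.D : ℝ) * θ.L * α₁ ≤ 1 / 8 ∧ α₀ ≤ cP ∧ α₁ ≤ cP ∧ lam.B₁' * (α₀ + α₁) ≤ cP ∧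
        2 * (lam.B₁' * (α₀ + α₁)) ^ 2 + 20 * θ.D * α₀ * (lam.B₁' * (α₀ + α₁)) + 2 * lam.C₂ * (lam.B₁' * (α₀ + α₁)) ^ 2 ≤ α₀ + α₁) ∧
      B8.Thm4Body c₁ lam.B₁' (fun i : {i : ZdIdx θ.D θ.L // (∀ j, i.Ω j = Set.univ) ∧ (∀ m j, i.Λs m j = {_y | j = m}) ∧ (∀ m j, i.Λb m j = {_c | j = m}) ∧
        i.η = ((θ.L : ℝ)⁻¹) ^ i.k} => (zdGF3 θ.𝔸 θ.L lam.β lam.len i.1).toGFData) ∧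
      B8.Prop3Body cP θ.D (θ.L : ℝ) lam.C₂ lam.inp lam.B₀β (fun i : {i : ZdIdx θ.D θ.L // (∀ j, i.Ω j = Set.univ) ∧ (∀ m j, i.Λs m j = {_y | j = m}) ∧
        (∀ m j, i.Λb m j = {_c | j = m}) ∧ i.η = ((θ.L : ℝ)⁻¹) ^ i.k} => (zdGF3 θ.𝔸 θ.L lam.β lam.len i.1).toGFData2) := by
  obtain ⟨c₁, hc₁, hT⟩ := h.t4P
  obtain ⟨cP, hcP, hP⟩ := h.p3P
  obtain ⟨c₁', hc₁', hwin⟩ := exists_window_print (d := θ.D) (L := θ.L) hD θ.two_le_L lam.C₂ hc₁ hcP hB₁'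
  exact ⟨c₁, c₁', cP, hc₁', hwin, thm4Body_pinned_of_t4P lam hT, prop3Body_pinned_of_p3P lam hP⟩

/-- ★ **`h5` IN θ's CURRENCY FROM n05-w1's P-SLOT + THE SIDE LETTERS**: the slot, `2 ≤ θ.D`, and the letters `λ.len ≥ 1` on its support, `λ.len e_μ = 1`, `0 < λ.B₁′`,
`5·θ.D·θ.L·λ.inp.B₀ ≤ λ.B₁′` give module 37ᴴ's `h5`-SHAPED existential with `(d, L, 𝔸) := (θ.D, θ.L, θ.𝔸)` and witnesses `len := λ.len`, `B₁′ := λ.B₁′`, `C₂ := λ.C₂`,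
`B₀β := λ.B₀β`, `inp := λ.inp`.  At a Stage-3 parameter whose `(𝔸, D, L)` unfold to `(M_N ℂ, 4, F.L)` this IS `h5 F` ∕ `stub_h5 λ.β F`; at the tree's `stage3OfFamily F`
(`𝔸 := ℂ`) it is the rank-one-algebra sentence (see the module docstring's LOCATED paragraph).  Nothing of Bałaban is proved.
[cite: Balaban1985RegularSpaces, Thm 4 p.88, Prop. 3 p.87, (1.61) p.86, p.77] [folklore] -/
theorem h5Letters_of_b8LeafOfRecordSubBP (hD : 2 ≤ θ.D) (lam : ResidB8 θ) (hlen : ∀ v : Site θ.D, 0 < lam.len v → 1 ≤ lam.len v)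
    (hlen1 : ∀ μ : Fin θ.D, lam.len (e μ) = 1) (hB₁' : 0 < lam.B₁') (hBB : 5 * (θ.D : ℝ) * θ.L * lam.inp.B₀ ≤ lam.B₁') (h : B8LeafOfRecordSubBP θ lam) :
    ∃ (len : Site θ.D → ℝ) (c₁ c₁' B₁' cP C₂ B₀β : ℝ) (inp : B8.B9Inputs),
      (∀ v : Site θ.D, 0 < len v → 1 ≤ len v) ∧ (∀ μ : Fin θ.D, len (e μ) = 1) ∧ 0 < B₁' ∧ 5 * (θ.D : ℝ) * θ.L * inp.B₀ ≤ B₁' ∧ 0 < c₁' ∧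
      (∀ α₀ α₁ : ℝ, 0 < α₀ → 0 < α₁ → α₀ + α₁ ≤ c₁' →
        α₀ + α₁ ≤ c₁ ∧ C0 θ.D * (2 * α₀) ≤ 1 / 3 ∧ 4 * α₀ ≤ c2' θ.D θ.L ∧ 16 * (B₁' * (α₀ + α₁)) ≤ 1 ∧
        Real.exp (4 * (800 * ((θ.D : ℝ) + 1) ^ 2 * ((θ.D : ℝ) + 4)) * α₀) * (1 + 8 * (131072 * ((θ.D : ℝ) + 1) ^ 2) * (B₁' * (α₀ + α₁))) ≤ 2 ∧
        2 * (B₁' * (α₀ + α₁)) ≤ c3 θ.D θ.L ∧ (θ.D : ℝ) * θ.L * α₁ ≤ 1 / 8 ∧ α₀ ≤ cP ∧ α₁ ≤ cP ∧ B₁' * (α₀ + α₁) ≤ cP ∧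
        2 * (B₁' * (α₀ + α₁)) ^ 2 + 20 * θ.D * α₀ * (B₁' * (α₀ + α₁)) + 2 * C₂ * (B₁' * (α₀ + α₁)) ^ 2 ≤ α₀ + α₁) ∧
      B8.Thm4Body c₁ B₁' (fun i : {i : ZdIdx θ.D θ.L // (∀ j, i.Ω j = Set.univ) ∧ (∀ m j, i.Λs m j = {_y | j = m}) ∧ (∀ m j, i.Λb m j = {_c | j = m}) ∧
        i.η = ((θ.L : ℝ)⁻¹) ^ i.k} => (zdGF3 θ.𝔸 θ.L lam.β len i.1).toGFData) ∧
      B8.Prop3Body cP θ.D (θ.L : ℝ) C₂ inp B₀β (fun i : {i : ZdIdx θ.D θ.L // (∀ j, i.Ω j = Set.univ) ∧ (∀ m j, i.Λs m j = {_y | j = m}) ∧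
        (∀ m j, i.Λb m j = {_c | j = m}) ∧ i.η = ((θ.L : ℝ)⁻¹) ^ i.k} => (zdGF3 θ.𝔸 θ.L lam.β len i.1).toGFData2) := by
  obtain ⟨c₁, c₁', cP, hc₁', hwin, hT, hP⟩ := leafLettersAT_of_b8LeafOfRecordSubBP hD lam hB₁' h
  exact ⟨lam.len, c₁, c₁', lam.B₁', cP, lam.C₂, lam.B₀β, lam.inp, hlen, hlen1, hB₁', hBB, hc₁', hwin, hT, hP⟩

end Slot

/-! ## §4 (v1.1) The WEAKEST node-N05-side currency for `h5`: Theorem 4 ∕ Proposition 3 AS PRINTED on the PINNED family only -/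

section PinnedPrinted

variable {N : ℕ}

/-- **`h5` FROM THEOREM 4 ∕ PROPOSITION 3 AS PRINTED ON THE PINNED `zdGF3` FAMILY ONLY** (`d = 4`, `𝔸 = M_N(ℂ)`, `L ≥ 2`, any `β`, `len`; the four side letters): node N05's two
sentences `B8.Thm4Printed B₁'` ∕ `B8.Prop3Printed 4 L C₂ inp B₀β` asked AT THE PINNED ALL-TORUS MEMBERS ONLY — N16's MINIMAL demand in the «as printed» currency (it is
`stub_h5` with the thresholds `c₁`, `cP` existential and the window supplied by `exists_window_print`).  §2's hypotheses (the P-slot's `t4P` ∕ `p3P` over the WHOLE four-law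
sub-index) imply these by §1 (`thm4Printed_pinned_of_subBP` ∕ `prop3Printed_pinned_of_subBP`); NOT conversely — the sub-index also holds members with holes at levels `j ≥ 1`.
Nothing of Bałaban is proved. [cite: Balaban1985RegularSpaces, Thm 4 p.88, Prop. 3 p.87, (1.61) p.86, p.77 («Ω_j = T_η»)] [folklore] -/
theorem h5_of_printed_pinned {L : ℕ} (hL : 2 ≤ L) (β : ℝ) {len : Site 4 → ℝ} (hlen : ∀ v : Site 4, 0 < len v → 1 ≤ len v) (hlen1 : ∀ μ : Fin 4, len (e μ) = 1)
    {B₁' C₂ B₀β : ℝ} {inp : B8.B9Inputs} (hB₁' : 0 < B₁') (hBB : 5 * ((4 : ℕ) : ℝ) * L * inp.B₀ ≤ B₁') :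
    letI : CStarAlgebra (Matrix (Fin N) (Fin N) ℂ) := {}
    B8.Thm4Printed B₁' (fun i : {i : ZdIdx 4 L // (∀ j, i.Ω j = Set.univ) ∧ (∀ m j, i.Λs m j = {_y | j = m}) ∧ (∀ m j, i.Λb m j = {_c | j = m}) ∧ i.η = ((L : ℝ)⁻¹) ^ i.k} => (zdGF3 (Matrix (Fin N) (Fin N) ℂ) L β len i.1).toGFData) →
    B8.Prop3Printed 4 (L : ℝ) C₂ inp B₀β (fun i : {i : ZdIdx 4 L // (∀ j, i.Ω j = Set.univ) ∧ (∀ m j, i.Λs m j = {_y | j = m}) ∧ (∀ m j, i.Λb m j = {_c | j = m}) ∧ i.η = ((L : ℝ)⁻¹) ^ i.k} => (zdGF3 (Matrix (Fin N) (Fin N) ℂ) L β len i.1).toGFData2) →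
    ∃ (len : Site 4 → ℝ) (c₁ c₁' B₁' cP C₂ B₀β : ℝ) (inp : B8.B9Inputs),
      (∀ v : Site 4, 0 < len v → 1 ≤ len v) ∧ (∀ μ : Fin 4, len (e μ) = 1) ∧ 0 < B₁' ∧ 5 * ((4 : ℕ) : ℝ) * L * inp.B₀ ≤ B₁' ∧ 0 < c₁' ∧
      (∀ α₀ α₁ : ℝ, 0 < α₀ → 0 < α₁ → α₀ + α₁ ≤ c₁' →
        α₀ + α₁ ≤ c₁ ∧ C0 4 * (2 * α₀) ≤ 1 / 3 ∧ 4 * α₀ ≤ c2' 4 L ∧ 16 * (B₁' * (α₀ + α₁)) ≤ 1 ∧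
        Real.exp (4 * (800 * (((4 : ℕ) : ℝ) + 1) ^ 2 * (((4 : ℕ) : ℝ) + 4)) * α₀) * (1 + 8 * (131072 * (((4 : ℕ) : ℝ) + 1) ^ 2) * (B₁' * (α₀ + α₁))) ≤ 2 ∧
        2 * (B₁' * (α₀ + α₁)) ≤ c3 4 L ∧ ((4 : ℕ) : ℝ) * L * α₁ ≤ 1 / 8 ∧ α₀ ≤ cP ∧ α₁ ≤ cP ∧ B₁' * (α₀ + α₁) ≤ cP ∧
        2 * (B₁' * (α₀ + α₁)) ^ 2 + 20 * ((4 : ℕ) : ℝ) * α₀ * (B₁' * (α₀ + α₁)) + 2 * C₂ * (B₁' * (α₀ + α₁)) ^ 2 ≤ α₀ + α₁) ∧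
      B8.Thm4Body c₁ B₁' (fun i : {i : ZdIdx 4 L // (∀ j, i.Ω j = Set.univ) ∧ (∀ m j, i.Λs m j = {_y | j = m}) ∧ (∀ m j, i.Λb m j = {_c | j = m}) ∧ i.η = ((L : ℝ)⁻¹) ^ i.k} => (zdGF3 (Matrix (Fin N) (Fin N) ℂ) L β len i.1).toGFData) ∧
      B8.Prop3Body cP 4 (L : ℝ) C₂ inp B₀β (fun i : {i : ZdIdx 4 L // (∀ j, i.Ω j = Set.univ) ∧ (∀ m j, i.Λs m j = {_y | j = m}) ∧ (∀ m j, i.Λb m j = {_c | j = m}) ∧ i.η = ((L : ℝ)⁻¹) ^ i.k} => (zdGF3 (Matrix (Fin N) (Fin N) ℂ) L β len i.1).toGFData2) := by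
  letI : CStarAlgebra (Matrix (Fin N) (Fin N) ℂ) := {}
  intro t4 p3
  obtain ⟨c₁, hc₁, hT⟩ := t4
  obtain ⟨cP, hcP, hP⟩ := p3
  obtain ⟨c₁', hc₁', hwin⟩ := exists_window_print (d := 4) (L := L) (by norm_num) hL C₂ hc₁ hcP hB₁'
  exact ⟨len, c₁, c₁', B₁', cP, C₂, B₀β, inp, hlen, hlen1, hB₁', hBB, hc₁', hwin, hT, hP⟩

/-- **THE SAME ON THE PINNED P-FAMILY** (node N05's P-carrier `zdGF3P` at the pinned members — it IS `zdGF3` there, g0's `thm4Body∕prop3Body_zdGF3P_pinned_iff`): Theorem 4 ∕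
Proposition 3 AS PRINTED on `fun i ↦ zdGF3P (M_N ℂ) L β len i.1` over the pinned sub-index, plus the side letters, give `h5`.  Nothing of Bałaban is proved.
[cite: Balaban1985RegularSpaces, Thm 4 p.88, Prop. 3 p.87, p.77] [folklore] -/
theorem h5_of_printedP_pinned {L : ℕ} (hL : 2 ≤ L) (β : ℝ) {len : Site 4 → ℝ} (hlen : ∀ v : Site 4, 0 < len v → 1 ≤ len v) (hlen1 : ∀ μ : Fin 4, len (e μ) = 1)
    {B₁' C₂ B₀β : ℝ} {inp : B8.B9Inputs} (hB₁' : 0 < B₁') (hBB : 5 * ((4 : ℕ) : ℝ) * L * inp.B₀ ≤ B₁') :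
    letI : CStarAlgebra (Matrix (Fin N) (Fin N) ℂ) := {}
    B8.Thm4Printed B₁' (fun i : {i : ZdIdx 4 L // (∀ j, i.Ω j = Set.univ) ∧ (∀ m j, i.Λs m j = {_y | j = m}) ∧ (∀ m j, i.Λb m j = {_c | j = m}) ∧ i.η = ((L : ℝ)⁻¹) ^ i.k} => (zdGF3P (Matrix (Fin N) (Fin N) ℂ) L β len i.1).toGFData) →
    B8.Prop3Printed 4 (L : ℝ) C₂ inp B₀β (fun i : {i : ZdIdx 4 L // (∀ j, i.Ω j = Set.univ) ∧ (∀ m j, i.Λs m j = {_y | j = m}) ∧ (∀ m j, i.Λb m j = {_c | j = m}) ∧ i.η = ((L : ℝ)⁻¹) ^ i.k} => (zdGF3P (Matrix (Fin N) (Fin N) ℂ) L β len i.1).toGFData2) →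
    ∃ (len : Site 4 → ℝ) (c₁ c₁' B₁' cP C₂ B₀β : ℝ) (inp : B8.B9Inputs),
      (∀ v : Site 4, 0 < len v → 1 ≤ len v) ∧ (∀ μ : Fin 4, len (e μ) = 1) ∧ 0 < B₁' ∧ 5 * ((4 : ℕ) : ℝ) * L * inp.B₀ ≤ B₁' ∧ 0 < c₁' ∧
      (∀ α₀ α₁ : ℝ, 0 < α₀ → 0 < α₁ → α₀ + α₁ ≤ c₁' →
        α₀ + α₁ ≤ c₁ ∧ C0 4 * (2 * α₀) ≤ 1 / 3 ∧ 4 * α₀ ≤ c2' 4 L ∧ 16 * (B₁' * (α₀ + α₁)) ≤ 1 ∧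
        Real.exp (4 * (800 * (((4 : ℕ) : ℝ) + 1) ^ 2 * (((4 : ℕ) : ℝ) + 4)) * α₀) * (1 + 8 * (131072 * (((4 : ℕ) : ℝ) + 1) ^ 2) * (B₁' * (α₀ + α₁))) ≤ 2 ∧
        2 * (B₁' * (α₀ + α₁)) ≤ c3 4 L ∧ ((4 : ℕ) : ℝ) * L * α₁ ≤ 1 / 8 ∧ α₀ ≤ cP ∧ α₁ ≤ cP ∧ B₁' * (α₀ + α₁) ≤ cP ∧
        2 * (B₁' * (α₀ + α₁)) ^ 2 + 20 * ((4 : ℕ) : ℝ) * α₀ * (B₁' * (α₀ + α₁)) + 2 * C₂ * (B₁' * (α₀ + α₁)) ^ 2 ≤ α₀ + α₁) ∧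
      B8.Thm4Body c₁ B₁' (fun i : {i : ZdIdx 4 L // (∀ j, i.Ω j = Set.univ) ∧ (∀ m j, i.Λs m j = {_y | j = m}) ∧ (∀ m j, i.Λb m j = {_c | j = m}) ∧ i.η = ((L : ℝ)⁻¹) ^ i.k} => (zdGF3 (Matrix (Fin N) (Fin N) ℂ) L β len i.1).toGFData) ∧
      B8.Prop3Body cP 4 (L : ℝ) C₂ inp B₀β (fun i : {i : ZdIdx 4 L // (∀ j, i.Ω j = Set.univ) ∧ (∀ m j, i.Λs m j = {_y | j = m}) ∧ (∀ m j, i.Λb m j = {_c | j = m}) ∧ i.η = ((L : ℝ)⁻¹) ^ i.k} => (zdGF3 (Matrix (Fin N) (Fin N) ℂ) L β len i.1).toGFData2) := by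
  letI : CStarAlgebra (Matrix (Fin N) (Fin N) ℂ) := {}
  intro t4 p3
  obtain ⟨c₁, hc₁, hT⟩ := t4
  obtain ⟨cP, hcP, hP⟩ := p3
  obtain ⟨c₁', hc₁', hwin⟩ := exists_window_print (d := 4) (L := L) (by norm_num) hL C₂ hc₁ hcP hB₁'
  exact ⟨len, c₁, c₁', B₁', cP, C₂, B₀β, inp, hlen, hlen1, hB₁', hBB, hc₁', hwin,
    (thm4Body_zdGF3P_pinned_iff (𝔸 := Matrix (Fin N) (Fin N) ℂ) (β := β) (len := len) c₁ B₁').1 hT,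
    (prop3Body_zdGF3P_pinned_iff (𝔸 := Matrix (Fin N) (Fin N) ℂ) (β := β) (len := len) cP C₂ inp B₀β).1 hP⟩

end PinnedPrinted

end Summit.QuantumFields.YangMills.BalabanUVNodes.N16H5OfPSlot

end
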